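import Summits.BirchSwinnertonDyer.BirchSwinnertonDyer.Theorems.ErratumRoadFiveBigRepInvariants
import Mathlib.RingTheory.QuotSMulTop
import Mathlib.Algebra.Ring.GeomSum
import HarnessLib

/-!
# On the invariants of `M = A ⊗ Λ^*(Ψ⁻¹)`, translation by `κ(g)` IS the action of `ρ(g)` on the values; hence
# `((1+T)^{N} − 1)` acts on `M^G` pointwise as `ρ(g₁) − 1` when `κ(g₁) = N` — and `T`-cotorsion is a quotient of
# `((1+T)^N − 1)`-cotorsion (helper, `--supports stmt-BirchSwinnertonDyer-25505`; steps 1–2 of the S2♭♭ roadmap)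

Cell `bsd-stepL`, seat `bsd-stepL-imc-p1` (prover g22, 2026-08-28). Theorems only (no definition, no named fact, no
`sorry`, no instance, no notation). First two steps of the ROADMAP (memo `HOME/imc-p1/g22/CORNER-25505-imc-p1-g22.md` §7) for
the kernel proof of the v4 stub `stub_localDefectFiniteAnomalous` of line `erratum_chain` of crux 25505 (finiteness of the LOCAL
control defect `𝓜^{Γ_{K_𝔭̄}}/T_c`): they convert the `Λ`-action on invariants into the Galois action on values, so that the
finiteness becomes a statement about `A_g` (step 3, the structure `𝓜^G/((1+T_c)^{p^t} − 1) ≅ (A_g^P/(ρ(g₁) − 1))^{p^{t+f}}`, and step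
4, the Galois named facts, are for the next seat). Pure algebra on the tree's co-induced model `BigRepModule` (smooth `p`-primary
functions `ℤ_p → A`, `(g·Φ)(x) = ρ(g)(Φ(x − κ g))`, `(T·Φ)(x) = Φ(x+1) − Φ(x)`), any group `G`, any coefficient ring.

## What is proved

* `apply_add_toAdd_of_forall_bigRep_eq` — for a `G`-invariant `Φ` and `g ∈ G`: `Φ(x + κ g) = ρ(g)(Φ x)` (read invariance at `x + κ g`).
* `one_add_X_pow_smul_apply` — `(((1+T)^N) • Φ)(x) = Φ(x + N)` (`1 + T` is translation by `1`).
* `one_add_X_pow_sub_one_smul_apply_of_forall_bigRep_eq` — for invariant `Φ` and `g₁` with `κ g₁ = N`: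
  `((((1+T)^N − 1)) • Φ)(x) = ρ(g₁)(Φ x) − Φ x` — on invariants `(1+T)^N − 1` IS the value-endomorphism `ρ(g₁) − 1`.
* `bigRep_apply_apply_of_kappa_eq_one` — for `κ g = 1`, `(g·Φ)(x) = ρ(g)(Φ x)` (used for the inner variable of the iterate:
  an element of `ker κ_ac` acts on `M' = bigRep κ_ac ρ` through the values only).
* `X_dvd_one_add_X_pow_sub_one`, `finite_quotSMulTop_of_dvd` — `T ∣ (1+T)^N − 1`, and for `a ∣ b` the `a`-cotorsion `M/aM` is a
  quotient of the `b`-cotorsion `M/bM`, so finite when the latter is (Mathlib `Submodule.factor_surjective`).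

HONEST FRAMING: module bookkeeping; nothing about any newform or curve; BSD is proved for no pair; closes: none (T7).

## References
* [JetchevSkinnerWan2017] §3.4, Lemma 3.4.1, proof (arXiv:1512.06894 p. 14: "`𝓜^{G_{K_v}}/(γ₊ − 1)𝓜^{G_{K_v}}`").
* [Castella2018] §2.1–2.2 (`𝒜 = T ⊗ Λ^*`, `ρ ⊗ Ψ⁻¹`, `1 + T ↦ γ`).
-/

noncomputable section

open PowerSeries Literature.NumberTheory.GaloisRepresentations Literature.NumberTheory.EllipticCurves
  Literature.NumberTheory.EllipticCurves.BigRepModule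
open scoped Pointwise

-- D-0017: single-problem summit, the namespace repeats the problem name by design.
set_option linter.dupNamespace false
set_option autoImplicit false

namespace Summit.BirchSwinnertonDyer.BirchSwinnertonDyer.Theorems.ErratumThm23TwoVariable.InvariantsShift

/-! ## §1 Cotorsion along a divisor -/

section Cotorsion

variable {R : Type*} [CommRing R] {M : Type*} [AddCommGroup M] [Module R M]

/-- For `a ∣ b`, `b • M ≤ a • M`. [folklore] -/
theorem smul_top_le_smul_top_of_dvd {a b : R} (h : a ∣ b) :
    (b • (⊤ : Submodule R M)) ≤ a • (⊤ : Submodule R M) := by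
  obtain ⟨q, rfl⟩ := h
  intro m hm
  rw [Submodule.mem_smul_pointwise_iff_exists] at hm
  obtain ⟨x, -, rfl⟩ := hm
  exact (Submodule.mem_smul_pointwise_iff_exists _ _ _).2 ⟨q • x, Submodule.mem_top, by rw [mul_smul]⟩

/-- **`M/aM` is a quotient of `M/bM` for `a ∣ b`**, hence finite when `M/bM` is. [folklore] -/
theorem finite_quotSMulTop_of_dvd {a b : R} (h : a ∣ b) [hb : Finite (QuotSMulTop b M)] :
    Finite (QuotSMulTop a M) :=
  Finite.of_surjective _ (Submodule.factor_surjective (smul_top_le_smul_top_of_dvd (M := M) h))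

/-- `T ∣ (1+T)^N − 1` in `R⟦T⟧` (indeed in any commutative ring: `x − 1 ∣ x^N − 1`). [folklore] -/
theorem X_dvd_one_add_X_pow_sub_one (N : ℕ) :
    (X : PowerSeries R) ∣ ((1 : PowerSeries R) + X) ^ N - 1 := by
  have h := sub_one_dvd_pow_sub_one ((1 : PowerSeries R) + X) N
  rwa [add_sub_cancel_left] at h

end Cotorsion

/-! ## §2 Translation on invariants is the value action -/

section Shift

variable {𝒪 : Type*} [CommRing 𝒪] [TopologicalSpace 𝒪] {p : ℕ} [Fact p.Prime]
  {A : Type*} [AddCommGroup A] [Module 𝒪 A] [TopologicalSpace A] [DiscreteTopology A]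
  {G : Type*} [Group G] [TopologicalSpace G] [ContinuousMul G] [TopologicalSpace (PowerSeries 𝒪)]
  (κ : G →ₜ* Multiplicative ℤ_[p]) (ρ : ContinuousRep G 𝒪 A)

/-- **On a `G`-invariant `Φ`, translating the variable by `κ(g)` is applying `ρ(g)` to the values**:
`Φ(x + κ g) = ρ(g)(Φ x)` (invariance `ρ(g)(Φ(y − κ g)) = Φ(y)` read at `y = x + κ g`).
[cite: Castella2018, §2.1 (the action ρ ⊗ Ψ^{-1} on 𝒜 = T ⊗ Λ^*)] -/
theorem apply_add_toAdd_of_forall_bigRep_eq {Φ : BigRepModule 𝒪 p A}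
    (hΦ : ∀ g : G, bigRep κ ρ g Φ = Φ) (g : G) (x : ℤ_[p]) :
    Φ (x + (κ g).toAdd) = ρ g (Φ x) := by
  have h := DFunLike.congr_fun (hΦ g) (x + (κ g).toAdd)
  rw [bigRep_apply_apply, add_sub_cancel_right] at h
  exact h.symm

omit [TopologicalSpace 𝒪] [TopologicalSpace A] [DiscreteTopology A] [TopologicalSpace (PowerSeries 𝒪)] in
/-- **`(1+T)^N` is translation by `N`**: `(((1+T)^N) • Φ)(x) = Φ(x + N)`. [cite: Castella2018, §2.2 (1 + T ↦ γ)] -/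
theorem one_add_X_pow_smul_apply (Φ : BigRepModule 𝒪 p A) (N : ℕ) (x : ℤ_[p]) :
    ((((1 : PowerSeries 𝒪) + X) ^ N) • Φ) x = Φ (x + N) := by
  induction N generalizing x with
  | zero => rw [pow_zero, one_smul, Nat.cast_zero, add_zero]
  | succ N ih =>
    rw [pow_succ', mul_smul, add_smul, one_smul, BigRepModule.add_apply, X_smul_apply, ih, ih,
      Nat.cast_succ, ← add_assoc, add_sub_cancel, add_right_comm]

/-- **On invariants, `(1+T)^N − 1` IS `ρ(g₁) − 1` on the values** when `κ g₁ = N`: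
`((((1+T)^N − 1)) • Φ)(x) = ρ(g₁)(Φ x) − Φ x` for `G`-invariant `Φ` — [JSW17]'s "`𝓜^{G_{K_v}}/(γ₊ − 1)`" with `γ₊`
realised by a group element. [cite: JetchevSkinnerWan2017, §3.4, Lemma 3.4.1, proof (arXiv:1512.06894 p. 14)] -/
theorem one_add_X_pow_sub_one_smul_apply_of_forall_bigRep_eq {Φ : BigRepModule 𝒪 p A}
    (hΦ : ∀ g : G, bigRep κ ρ g Φ = Φ) {g₁ : G} {N : ℕ} (hg₁ : (κ g₁).toAdd = (N : ℤ_[p])) (x : ℤ_[p]) :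
    ((((1 : PowerSeries 𝒪) + X) ^ N - 1) • Φ) x = ρ g₁ (Φ x) - Φ x := by
  rw [sub_smul, one_smul, BigRepModule.sub_apply, one_add_X_pow_smul_apply, ← hg₁,
    apply_add_toAdd_of_forall_bigRep_eq κ ρ hΦ g₁ x]

/-- **An element of `ker κ` acts on `M` through the values only**: `(g·Φ)(x) = ρ(g)(Φ x)` when `κ g = 1` (for the
iterate: an element of `ker κ_ac` acts on the inner big representation `M' = A ⊗ Λ_ac^*` by `ρ` on the values).
[cite: Castella2018, §2.1 (the action ρ ⊗ Ψ^{-1})] -/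
theorem bigRep_apply_apply_of_kappa_eq_one {g : G} (hg : κ g = 1) (Φ : BigRepModule 𝒪 p A) (x : ℤ_[p]) :
    bigRep κ ρ g Φ x = ρ g (Φ x) := by
  rw [bigRep_apply_apply, hg, toAdd_one, sub_zero]

variable [ContinuousSMul (PowerSeries 𝒪) (BigRepModule 𝒪 p A)]

/-- **The `T`-cotorsion of the invariants `M^G` is finite as soon as their `((1+T)^N − 1)`-cotorsion is** (`T ∣ (1+T)^N − 1`) —
with `one_add_X_pow_sub_one_smul_apply_of_forall_bigRep_eq` this reduces "`M^G/T M^G` finite" to the finiteness of the cokernel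
of the VALUE endomorphism `ρ(g₁) − 1` on `M^G` for any `g₁` with `κ g₁ = N ≥ 1`.
[cite: JetchevSkinnerWan2017, §3.4, Lemma 3.4.1, proof (arXiv:1512.06894 p. 14)] -/
theorem finite_quotSMulTop_X_invariants_of_pow (N : ℕ)
    [Finite (QuotSMulTop (((1 : PowerSeries 𝒪) + X) ^ N - 1) ↥((bigRep (p := p) κ ρ).toTopRep.ρ.invariants))] :
    Finite (QuotSMulTop (X : PowerSeries 𝒪) ↥((bigRep (p := p) κ ρ).toTopRep.ρ.invariants)) :=
  finite_quotSMulTop_of_dvd (X_dvd_one_add_X_pow_sub_one N)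

end Shift

end Summit.BirchSwinnertonDyer.BirchSwinnertonDyer.Theorems.ErratumThm23TwoVariable.InvariantsShift

end
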